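import Summits.Ventures.CertifiedArithmetic.LowPrec.TheoremsR1

/-!
# Every FP6/FP4 product and sum is exact in the wide accumulators — the complete instance matrix

HONEST FRAMING (venture CertifiedArithmetic / cell `pub-lowprec`): certified error envelopes and
provably optimal rounding/accumulation schemes for low-precision formats under stated cost models;
every table by two implementations; no hardware or vendor claims.

The enum seat's exhaustive tables (ENVELOPES.md §2; campaigns `canary` + `fp6fp4mixed`, all nine
ordered operand pairs over `{E3M2, E2M3, E2M1}`, implementation A = implementation B) certify:
every product of two FP6/FP4 data is a value of `binary16`, `bfloat16` and `binary32`, and every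
sum is a value of `binary16` and `binary32`, and of `bfloat16` for every pair EXCEPT `E3M2 + E3M2`.
This file makes that headline a Lean theorem for the whole matrix:
* products into `binary16` — instances of THEOREMS-R1 Theorem P (`theoremP_holds`; the
  `bfloat16`/`binary32` product instances are already in `ExactInstances.lean`, and
  `E3M2 · E3M2 → binary16` in `TheoremsR1.lean`);
* sums — instances of Theorem S, coarse form (`theoremS0_holds`) wherever its hypothesis (ii₀)
  `M_X + M_Y < 2^(P_R + L)` holds (12 new instances; `E2M1+E2M1 → binary16`, `E3M2+E3M2 → binary32`,
  `E2M3+E2M3 → bfloat16` are in `TheoremsR1.lean`);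
* the two sums into `bfloat16` where (ii₀) FAILS but the table is exact — `E3M2 + E2M3` and
  `E3M2 + E2M1` (THEOREMS-R1 Lemma C′: the odd significand of any such sum spans ≤ 8 resp. ≤ 7
  bits) — by kernel-exhaustive evaluation of `roundNE bfloat16` on all 4096 resp. 1024 ordered
  pairs;
* the one negative entry, `E3M2 + E3M2 ↛ bfloat16`, with the kernel-checked witness `16 + 1/16`
  (`257 · 2⁻⁴`, nine significant bits);
* symmetry in the operands, so the ordered pairs follow from the unordered ones.
No new definitions. Drafted by the enum seat (gen4) against the landed substrate.
-/

namespace Summit.Ventures.CertifiedArithmetic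

open Literature.ComputerArithmetic.FloatingPoint
open Literature.ComputerArithmetic.FloatingPoint.MiniFloat
open Literature.ComputerArithmetic.FloatingPoint.Format

/-! ### Symmetry and the exhaustive test -/

/-- Exact sums are symmetric in the operand formats. -/
theorem ExactSums.symm {φ₁ φ₂ ψ : Format} (h : ExactSums φ₁ φ₂ ψ) : ExactSums φ₂ φ₁ ψ := by
  intro x y
  obtain ⟨z, hz⟩ := h y x
  exact ⟨z, by rw [hz, add_comm]⟩

/-- Exact products are symmetric in the operand formats. -/
theorem R2_ExactProducts.symm {φ₁ φ₂ ψ : Format} (h : R2_ExactProducts φ₁ φ₂ ψ) :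
    R2_ExactProducts φ₂ φ₁ ψ := by
  intro x y
  obtain ⟨z, hz⟩ := h y x
  exact ⟨z, by rw [hz, mul_comm]⟩

/-- Exhaustive route to `ExactSums`: if `roundNE ψ (x + y)` returns `x + y` for every pair of the
explicit lists `all φ₁ × all φ₂`, every sum is a value of `ψ` (the rounded datum is the witness). -/
theorem exactSums_of_all {φ₁ φ₂ : Format} (ψ : Format)
    (h : ((all φ₁).all fun x => (all φ₂).all fun y =>
      decide ((roundNE ψ (x.toRat + y.toRat)).toRat = x.toRat + y.toRat)) = true) :
    ExactSums φ₁ φ₂ ψ :=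
  fun x y => ⟨roundNE ψ (x.toRat + y.toRat), of_decide_eq_true (forall₂_of_all_all h x y)⟩

/-- Chunking for kernel evaluation: a Boolean `all` over a list follows from the same `all` over
`take n` and `drop n` (keeps each `decide +kernel` call at ≤ 1024 `bfloat16` roundings). -/
theorem all_of_take_drop {α : Type} {l : List α} {P : α → Bool} (n : ℕ)
    (h1 : (l.take n).all P = true) (h2 : (l.drop n).all P = true) : l.all P = true := by
  rw [← List.take_append_drop n l, List.all_append, h1, h2]; rfl

/-! ### Products into `binary16` (Theorem P instances) -/

/-- Every product of two FP6/FP4 data is a value of `binary16`: the five unordered pairs not yet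
in the tree (`E3M2 · E3M2` is `E3M2_mul_E3M2_exact_in_Binary16'`). Theorem P: `P_X + P_Y ≤ 11`,
`L_X + L_Y ≥ -24`, `M_X M_Y ≤ 65504`. -/
theorem products_exact_in_Binary16 :
    R2_ExactProducts E3M2 E2M3 Binary16 ∧ R2_ExactProducts E3M2 E2M1 Binary16 ∧
    R2_ExactProducts E2M3 E2M3 Binary16 ∧ R2_ExactProducts E2M3 E2M1 Binary16 ∧
    R2_ExactProducts E2M1 E2M1 Binary16 := by
  refine ⟨theoremP_holds _ _ _ (by decide) (by decide) ?_,
    theoremP_holds _ _ _ (by decide) (by decide) ?_,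
    theoremP_holds _ _ _ (by decide) (by decide) ?_,
    theoremP_holds _ _ _ (by decide) (by decide) ?_,
    theoremP_holds _ _ _ (by decide) (by decide) ?_⟩
  · rw [E3M2_maxRat.1, E2M3_maxRat.1, Binary16_maxRat.1]; norm_num
  · rw [E3M2_maxRat.1, E2M1_maxRat.1, Binary16_maxRat.1]; norm_num
  · rw [E2M3_maxRat.1, Binary16_maxRat.1]; norm_num
  · rw [E2M3_maxRat.1, E2M1_maxRat.1, Binary16_maxRat.1]; norm_num
  · rw [E2M1_maxRat.1, Binary16_maxRat.1]; norm_num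

/-! ### Sums by Theorem S₀ (parameter level) -/

/-- Sums into `binary16` (`P_R = 11`, `L_R = -24`): all five remaining unordered FP6/FP4 pairs are
exact by Theorem S₀ (`E2M1 + E2M1` is in `exactSums_instances`). E.g. `E3M2 + E2M1`:
`L = -4`, `28 + 6 = 34 < 2^(11-4) = 128`. -/
theorem sums_exact_in_Binary16 :
    ExactSums E3M2 E3M2 Binary16 ∧ ExactSums E2M3 E2M3 Binary16 ∧ ExactSums E3M2 E2M3 Binary16 ∧
    ExactSums E3M2 E2M1 Binary16 ∧ ExactSums E2M3 E2M1 Binary16 := by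
  refine ⟨theoremS0_holds _ _ _ (by decide) ?_ ?_, theoremS0_holds _ _ _ (by decide) ?_ ?_,
    theoremS0_holds _ _ _ (by decide) ?_ ?_, theoremS0_holds _ _ _ (by decide) ?_ ?_,
    theoremS0_holds _ _ _ (by decide) ?_ ?_⟩
  · rw [E3M2_maxRat.1,
      show ((Binary16.manBits : ℤ) + 1 + min E3M2.qexp E3M2.qexp) = 7 by decide]; norm_num
  · rw [E3M2_maxRat.1, Binary16_maxRat.1]; norm_num
  · rw [E2M3_maxRat.1,
      show ((Binary16.manBits : ℤ) + 1 + min E2M3.qexp E2M3.qexp) = 8 by decide]; norm_num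
  · rw [E2M3_maxRat.1, Binary16_maxRat.1]; norm_num
  · rw [E3M2_maxRat.1, E2M3_maxRat.1,
      show ((Binary16.manBits : ℤ) + 1 + min E3M2.qexp E2M3.qexp) = 7 by decide]; norm_num
  · rw [E3M2_maxRat.1, E2M3_maxRat.1, Binary16_maxRat.1]; norm_num
  · rw [E3M2_maxRat.1, E2M1_maxRat.1,
      show ((Binary16.manBits : ℤ) + 1 + min E3M2.qexp E2M1.qexp) = 7 by decide]; norm_num
  · rw [E3M2_maxRat.1, E2M1_maxRat.1, Binary16_maxRat.1]; norm_num
  · rw [E2M3_maxRat.1, E2M1_maxRat.1,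
      show ((Binary16.manBits : ℤ) + 1 + min E2M3.qexp E2M1.qexp) = 8 by decide]; norm_num
  · rw [E2M3_maxRat.1, E2M1_maxRat.1, Binary16_maxRat.1]; norm_num

/-- Sums into `bfloat16` (`P_R = 8`, `L_R = -133`) by Theorem S₀: `E2M1 + E2M1` (`12 < 2^7`) and
`E2M3 + E2M1` (`13.5 < 2^5`); `E2M3 + E2M3` is in `TheoremsR1.lean`. -/
theorem sums_exact_in_BFloat16_S0 :
    ExactSums E2M1 E2M1 BFloat16 ∧ ExactSums E2M3 E2M1 BFloat16 := by
  refine ⟨theoremS0_holds _ _ _ (by decide) ?_ ?_, theoremS0_holds _ _ _ (by decide) ?_ ?_⟩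
  · rw [E2M1_maxRat.1,
      show ((BFloat16.manBits : ℤ) + 1 + min E2M1.qexp E2M1.qexp) = 7 by decide]; norm_num
  · rw [E2M1_maxRat.1, BFloat16_maxRat.1]; norm_num
  · rw [E2M3_maxRat.1, E2M1_maxRat.1,
      show ((BFloat16.manBits : ℤ) + 1 + min E2M3.qexp E2M1.qexp) = 5 by decide]; norm_num
  · rw [E2M3_maxRat.1, E2M1_maxRat.1, BFloat16_maxRat.1]; norm_num

/-- Sums into `binary32` (`P_R = 24`, `L_R = -149`) by Theorem S₀: the five remaining unordered
pairs (`E3M2 + E3M2` is in `exactSums_instances`). -/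
theorem sums_exact_in_Binary32 :
    ExactSums E2M1 E2M1 Binary32 ∧ ExactSums E2M3 E2M3 Binary32 ∧ ExactSums E3M2 E2M3 Binary32 ∧
    ExactSums E3M2 E2M1 Binary32 ∧ ExactSums E2M3 E2M1 Binary32 := by
  refine ⟨theoremS0_holds _ _ _ (by decide) ?_ ?_, theoremS0_holds _ _ _ (by decide) ?_ ?_,
    theoremS0_holds _ _ _ (by decide) ?_ ?_, theoremS0_holds _ _ _ (by decide) ?_ ?_,
    theoremS0_holds _ _ _ (by decide) ?_ ?_⟩
  · rw [E2M1_maxRat.1,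
      show ((Binary32.manBits : ℤ) + 1 + min E2M1.qexp E2M1.qexp) = 23 by decide]; norm_num
  · rw [E2M1_maxRat.1, Binary32_maxRat.1]; norm_num
  · rw [E2M3_maxRat.1,
      show ((Binary32.manBits : ℤ) + 1 + min E2M3.qexp E2M3.qexp) = 21 by decide]; norm_num
  · rw [E2M3_maxRat.1, Binary32_maxRat.1]; norm_num
  · rw [E3M2_maxRat.1, E2M3_maxRat.1,
      show ((Binary32.manBits : ℤ) + 1 + min E3M2.qexp E2M3.qexp) = 20 by decide]; norm_num
  · rw [E3M2_maxRat.1, E2M3_maxRat.1, Binary32_maxRat.1]; norm_num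
  · rw [E3M2_maxRat.1, E2M1_maxRat.1,
      show ((Binary32.manBits : ℤ) + 1 + min E3M2.qexp E2M1.qexp) = 20 by decide]; norm_num
  · rw [E3M2_maxRat.1, E2M1_maxRat.1, Binary32_maxRat.1]; norm_num
  · rw [E2M3_maxRat.1, E2M1_maxRat.1,
      show ((Binary32.manBits : ℤ) + 1 + min E2M3.qexp E2M1.qexp) = 21 by decide]; norm_num
  · rw [E2M3_maxRat.1, E2M1_maxRat.1, Binary32_maxRat.1]; norm_num

/-! ### Sums into `bfloat16` beyond Theorem S₀ (Lemma C′ cases, kernel-exhaustive) -/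

/-- `E3M2 + E2M1 → bfloat16` is exact although (ii₀) fails (`28 + 6 = 34 ≥ 2^(8-4) = 16`): the
low-bit holder bounds the span by 7 bits (THEOREMS-R1 Lemma C′); here by kernel evaluation of
`roundNE bfloat16` on all `64 × 16` ordered pairs. -/
theorem E3M2_add_E2M1_exact_in_BFloat16 : ExactSums E3M2 E2M1 BFloat16 :=
  exactSums_of_all BFloat16 (by decide +kernel)

/-- Chunk 1 of `E3M2_add_E2M3_exact_in_BFloat16`: `roundNE bfloat16 (x + y) = x + y` for the
first 16 data `x` of `all E3M2` and every `y : E2M3` (kernel evaluation, 1024 pairs). -/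
theorem E3M2_add_E2M3_bf16_chunk₁ :
    ((((all E3M2).take 32).take 16).all fun x => (all E2M3).all fun y =>
      decide ((roundNE BFloat16 (x.toRat + y.toRat)).toRat = x.toRat + y.toRat)) = true := by
  decide +kernel

/-- Chunk 2 of `E3M2_add_E2M3_exact_in_BFloat16` (outer data 17–32 of `all E3M2`). -/
theorem E3M2_add_E2M3_bf16_chunk₂ :
    ((((all E3M2).take 32).drop 16).all fun x => (all E2M3).all fun y =>
      decide ((roundNE BFloat16 (x.toRat + y.toRat)).toRat = x.toRat + y.toRat)) = true := by
  decide +kernel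

/-- Chunk 3 of `E3M2_add_E2M3_exact_in_BFloat16` (outer data 33–48 of `all E3M2`). -/
theorem E3M2_add_E2M3_bf16_chunk₃ :
    ((((all E3M2).drop 32).take 16).all fun x => (all E2M3).all fun y =>
      decide ((roundNE BFloat16 (x.toRat + y.toRat)).toRat = x.toRat + y.toRat)) = true := by
  decide +kernel

/-- Chunk 4 of `E3M2_add_E2M3_exact_in_BFloat16` (outer data 49–64 of `all E3M2`). -/
theorem E3M2_add_E2M3_bf16_chunk₄ :
    ((((all E3M2).drop 32).drop 16).all fun x => (all E2M3).all fun y =>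
      decide ((roundNE BFloat16 (x.toRat + y.toRat)).toRat = x.toRat + y.toRat)) = true := by
  decide +kernel

/-- `E3M2 + E2M3 → bfloat16` is exact although (ii₀) fails (`28 + 7.5 ≥ 16`): span ≤ 8 bits by
Lemma C′ (the bound is attained, e.g. `16 + 15/8 = 143 · 2⁻³`); here by kernel evaluation on all
`64 × 64` ordered pairs, in four chunks of `16 × 64`. -/
theorem E3M2_add_E2M3_exact_in_BFloat16 : ExactSums E3M2 E2M3 BFloat16 :=
  exactSums_of_all BFloat16
    (all_of_take_drop 32 (all_of_take_drop 16 E3M2_add_E2M3_bf16_chunk₁ E3M2_add_E2M3_bf16_chunk₂)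
      (all_of_take_drop 16 E3M2_add_E2M3_bf16_chunk₃ E3M2_add_E2M3_bf16_chunk₄))

/-! ### The negative entry -/

/-- The `E3M2` datum `16` (exponent code 7, trailing significand 0). -/
theorem sixteen_E3M2_toRat :
    (⟨false, 7, 0, by decide, by decide, by decide⟩ : MiniFloat E3M2).toRat = 16 := by
  decide +kernel

/-- The `E3M2` datum `1/16` (the least subnormal: exponent code 0, trailing significand 1). -/
theorem quantum_E3M2_toRat :
    (⟨false, 0, 1, by decide, by decide, by decide⟩ : MiniFloat E3M2).toRat = 1 / 16 := by
  decide +kernel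

/-- `E3M2 + E3M2` is NOT exact in `bfloat16`: `16 + 1/16 = 257 · 2⁻⁴` has nine significant bits,
so it is not a `bfloat16` value (THEOREMS-R1 Theorem S′(a) witness `2^k + 2^l`, `k - l = P_R = 8`);
formally, a value would be a fixed point of `roundNE bfloat16`, and the kernel evaluates
`roundNE bfloat16 (257/16) ≠ 257/16`. -/
theorem E3M2_add_E3M2_not_exact_in_BFloat16 : ¬ ExactSums E3M2 E3M2 BFloat16 := by
  intro h
  obtain ⟨z, hz⟩ :=
    h ⟨false, 7, 0, by decide, by decide, by decide⟩ ⟨false, 0, 1, by decide, by decide, by decide⟩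
  have hfix := toRat_roundNE_toRat z
  rw [hz] at hfix
  have hne : (roundNE BFloat16
      ((⟨false, 7, 0, by decide, by decide, by decide⟩ : MiniFloat E3M2).toRat +
       (⟨false, 0, 1, by decide, by decide, by decide⟩ : MiniFloat E3M2).toRat)).toRat ≠
      (⟨false, 7, 0, by decide, by decide, by decide⟩ : MiniFloat E3M2).toRat +
       (⟨false, 0, 1, by decide, by decide, by decide⟩ : MiniFloat E3M2).toRat := by
    decide +kernel
  exact hne hfix

/-! ### The matrix, ordered pairs included -/

/-- HEADLINE (ENVELOPES.md §2, all nine ordered FP6/FP4 operand pairs): every sum is a value of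
`binary16` and of `binary32`; every sum is a value of `bfloat16` except for the pair
`E3M2 + E3M2`. -/
theorem fp6fp4_sums_exact_wide :
    (∀ φ₁ ∈ [E3M2, E2M3, E2M1], ∀ φ₂ ∈ [E3M2, E2M3, E2M1],
      ExactSums φ₁ φ₂ Binary16 ∧ ExactSums φ₁ φ₂ Binary32) ∧
    (∀ φ₁ ∈ [E3M2, E2M3, E2M1], ∀ φ₂ ∈ [E3M2, E2M3, E2M1], (φ₁, φ₂) ≠ (E3M2, E3M2) →
      ExactSums φ₁ φ₂ BFloat16) ∧
    ¬ ExactSums E3M2 E3M2 BFloat16 := by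
  obtain ⟨a1, a2, a3, a4, a5⟩ := sums_exact_in_Binary16
  obtain ⟨c1, c2, c3, c4, c5⟩ := sums_exact_in_Binary32
  obtain ⟨b1, b2⟩ := sums_exact_in_BFloat16_S0
  obtain ⟨e1, e2, _⟩ := exactSums_instances
  have b3 := E2M3_add_E2M3_exact_in_BFloat16
  have b4 := E3M2_add_E2M1_exact_in_BFloat16
  have b5 := E3M2_add_E2M3_exact_in_BFloat16
  refine ⟨?_, ?_, E3M2_add_E3M2_not_exact_in_BFloat16⟩
  · intro φ₁ h₁ φ₂ h₂
    simp only [List.mem_cons, List.mem_nil_iff, or_false] at h₁ h₂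
    rcases h₁ with rfl | rfl | rfl <;> rcases h₂ with rfl | rfl | rfl
    exacts [⟨a1, e2⟩, ⟨a3, c3⟩, ⟨a4, c4⟩, ⟨a3.symm, c3.symm⟩, ⟨a2, c2⟩, ⟨a5, c5⟩,
      ⟨a4.symm, c4.symm⟩, ⟨a5.symm, c5.symm⟩, ⟨e1, c1⟩]
  · intro φ₁ h₁ φ₂ h₂ hne
    simp only [List.mem_cons, List.mem_nil_iff, or_false] at h₁ h₂
    rcases h₁ with rfl | rfl | rfl <;> rcases h₂ with rfl | rfl | rfl
    exacts [absurd rfl hne, b5, b4, b5.symm, b3, b2, b4.symm, b2.symm, b1]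

/-- HEADLINE, products: every product of two FP6/FP4 data (all nine ordered pairs) is a value of
`binary16` (and of `bfloat16`, `binary32`: `ExactInstances.lean`). -/
theorem fp6fp4_products_exact_in_Binary16 :
    ∀ φ₁ ∈ [E3M2, E2M3, E2M1], ∀ φ₂ ∈ [E3M2, E2M3, E2M1], R2_ExactProducts φ₁ φ₂ Binary16 := by
  obtain ⟨p1, p2, p3, p4, p5⟩ := products_exact_in_Binary16
  have p0 := E3M2_mul_E3M2_exact_in_Binary16'
  intro φ₁ h₁ φ₂ h₂
  simp only [List.mem_cons, List.mem_nil_iff, or_false] at h₁ h₂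
  rcases h₁ with rfl | rfl | rfl <;> rcases h₂ with rfl | rfl | rfl
  exacts [p0, p1, p2, p1.symm, p3, p4, p2.symm, p4.symm, p5]

end Summit.Ventures.CertifiedArithmetic
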